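import Mathlib
import HarnessLib
import Summits.NavierStokesRegularity.NavierStokesRegularity.Theorems.PoloidalWindowDoorLrcModEntireJetCertPsatzElimN

/-!
# Jet-certificate checker — transcript replay with AUTOMATIC CONTENT REMOVAL in a pinned tilt letter `g`
# (laws divided by `g^a` and by `(1 + g²)^b` after every substitution; for the all-tilt cells of arm C)

Cell pub-ns-dss, seat ns-crc-p1 gen 5 (Lean-certificate hand of `ns-wall-extremal`, arm C; PREREG-WALL-1 §C (C2 «ALL-γ» cells), CERT-FORMAT-C v0.2 §5),
2026-08-28. `--supports stmt-NavierStokesRegularity-19708` (instrument).  Generic; no Navier–Stokes content.  In a γ-symbolic elimination every pivot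
coefficient is `κ·g^a(1+g²)^b`; clearing denominators multiplies the other laws by such factors, which then ACCUMULATE (on T1′(3,2) up to
`g^419(1+g²)^26`; the engine of record divides these contents out at every step).  This variant strips them inside the kernel replay: after each `elim`
substitution every LAW is divided by the largest power of `X_g` dividing all its terms (`stripG`; sound because `X_g` is a pin, i.e. non-zero at the
point) and then repeatedly by `1 + X_g²` as long as the division is exact (`stripQuad`; the quotient is FOUND by a peeling heuristic and VERIFIED by
re-multiplication, and `1 + z_g² > 0`).  Pins and sign constraints are left untouched.  Same nodes (`ETree`), same conclusion (`Kills`).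

* `minExpG`, `lowerG`, `ev_lowerG`, `stripG`, `ev_stripG`; `peelQuad`, `stripQuad`, `ev_stripQuad`; `stripC` (+ `ev_stripC_eq_zero`);
* `hasVarPin` (the pin list contains `X_g` syntactically); `etreeCheckG n g` + **`not_pointDatum_of_etreeCheckG`**; `killCheckG` + **`kills_of_killCheckG`**;
* self-test (`decide +kernel`).

WHAT THIS IS NOT: not a claim about Navier–Stokes, not a certificate. [folklore]
-/

noncomputable section

-- the summit and its single sub-problem share the name (CONVENTIONS §1), as in every Theorems file
set_option linter.dupNamespace false

namespace Summit.NavierStokesRegularity.NavierStokesRegularity.Theorems.PoloidalWindowDoorLrcModEntireJetCertPsatzElimG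

open _root_.Topology _root_.Filter Set
open Literature.Analysis.ValidatedNumerics Literature.Analysis.ValidatedNumerics.QMvPoly
open Literature.Analysis.Calculus.MvPoly
open Summit.NavierStokesRegularity.NavierStokesRegularity.Theorems.PoloidalWindowDoorLrcModEntireJetCertDefs
open Summit.NavierStokesRegularity.NavierStokesRegularity.Theorems.PoloidalWindowDoorLrcModEntireJetCertTree
open Summit.NavierStokesRegularity.NavierStokesRegularity.Theorems.PoloidalWindowDoorLrcModEntireJetCertFast2
open Summit.NavierStokesRegularity.NavierStokesRegularity.Theorems.PoloidalWindowDoorLrcModEntireJetCertGauge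
open Summit.NavierStokesRegularity.NavierStokesRegularity.Theorems.PoloidalWindowDoorLrcModEntireJetCertPsatz
open Summit.NavierStokesRegularity.NavierStokesRegularity.Theorems.PoloidalWindowDoorLrcModEntireJetCertPsatzSubst
open Summit.NavierStokesRegularity.NavierStokesRegularity.Theorems.PoloidalWindowDoorLrcModEntireJetCertPsatzElim
open Summit.NavierStokesRegularity.NavierStokesRegularity.Theorems.PoloidalWindowDoorLrcModEntireJetCertPsatzElimN

variable {n : ℕ}

/-! ### Dividing a law by a power of the pinned letter -/

/-- The smallest exponent of `X_g` among the terms (`0` for the empty list). [folklore] -/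
def minExpG (g : ℕ) : QMvPoly → ℕ
  | [] => 0
  | [t] => t.1.getD g 0
  | t :: q => min (t.1.getD g 0) (minExpG g q)

/-- Every term has `g`-exponent at least `minExpG`. [folklore] -/
theorem minExpG_le (g : ℕ) : ∀ (p : QMvPoly), ∀ t ∈ p, minExpG g p ≤ t.1.getD g 0 := by
  intro p
  induction p with
  | nil => intro t ht; simp at ht
  | cons u q ih =>
    intro t ht
    cases q with
    | nil => simp at ht; subst ht; simp [minExpG]
    | cons v r =>
      simp only [minExpG]
      rcases List.mem_cons.1 ht with rfl | ht'
      · exact min_le_left _ _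
      · exact le_trans (min_le_right _ _) (ih t ht')

/-- Lower the `g`-exponent of every term by `a` (as `X^{m[g↦0]} · X_g^(m_g − a)`, normalised). [folklore] -/
def lowerG (n g a : ℕ) (p : QMvPoly) : QMvPoly :=
  normalizeS (trimQ ((p.map fun t => mulN [(zeroAt t.1 g, t.2)] (powQN (QMvPoly.var n g) (t.1.getD g 0 - a))).flatten))

/-- `X_g^a · (lowerG p)(z) = p(z)` when every term has `g`-exponent `≥ a`. [folklore] -/
theorem ev_lowerG (z : EuclideanSpace ℝ (Fin n)) (g : Fin n) (a : ℕ) :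
    ∀ p : QMvPoly, (∀ t ∈ p, a ≤ t.1.getD g 0) → z g ^ a * ev n (lowerG n g a p) z = ev n p z := by
  intro p hp
  rw [lowerG, ev_normalizeS, ev_trimQ]
  induction p with
  | nil => simp
  | cons t q ih =>
    have ht : a ≤ t.1.getD g 0 := hp t (by simp)
    rw [List.map_cons, List.flatten_cons, ev_append, mul_add, ih (fun u hu => hp u (by simp [hu])), show t :: q = [t] ++ q from rfl,
      ev_append, ev_mulN, ev_powQN, ev_var, ev_single, ev_single, prod_pow_split z t.1 g]
    congr 1
    have : z g ^ a * z g ^ (t.1.getD g 0 - a) = z g ^ t.1.getD g 0 := by rw [← pow_add, Nat.add_sub_cancel' ht]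
    calc z g ^ a * ((t.2 : ℝ) * (∏ j : Fin n, z j ^ (zeroAt t.1 g).getD j 0) * z g ^ (t.1.getD g 0 - a))
        = (t.2 : ℝ) * (∏ j : Fin n, z j ^ (zeroAt t.1 g).getD j 0) * (z g ^ a * z g ^ (t.1.getD g 0 - a)) := by ring
      _ = (t.2 : ℝ) * ((∏ j : Fin n, z j ^ (zeroAt t.1 g).getD j 0) * z g ^ t.1.getD g 0) := by rw [this]; ring

/-- Strip the common power of `X_g`. [folklore] -/
def stripG (n g : ℕ) (p : QMvPoly) : QMvPoly := lowerG n g (minExpG g p) p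

/-- `X_g^(minExp) · (stripG p)(z) = p(z)`. [folklore] -/
theorem ev_stripG (z : EuclideanSpace ℝ (Fin n)) (g : Fin n) (p : QMvPoly) :
    z g ^ minExpG g p * ev n (stripG n g p) z = ev n p z :=
  ev_lowerG z g _ p (minExpG_le (g : ℕ) p)

/-! ### Dividing a law by `1 + X_g²` (quotient found by peeling, verified by multiplication) -/

/-- The largest exponent of `X_g` among the terms. [folklore] -/
def maxExpG (g : ℕ) (p : QMvPoly) : ℕ := p.foldr (fun t d => max (t.1.getD g 0) d) 0

/-- `1 + X_g²` as a term list. [folklore] -/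
def onePlusSq (n g : ℕ) : QMvPoly := QMvPoly.const 1 ++ powQN (QMvPoly.var n g) 2

/-- Peel a candidate quotient by `1 + X_g²`: repeatedly move the top `g`-degree layer, lowered by two, into the quotient (fuel-bounded). [folklore] -/
def peelQuad (n g : ℕ) : ℕ → QMvPoly → QMvPoly → QMvPoly × QMvPoly
  | 0, R, Q => (R, Q)
  | f + 1, R, Q =>
      let m := maxExpG g R
      if m < 2 then (R, Q) else
        let T' := normalizeS (trimQ ((R.filter fun t => t.1.getD g 0 = m).map fun t => (zeroAt t.1 g, t.2)))
        let T2 := mulN T' (powQN (QMvPoly.var n g) (m - 2))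
        peelQuad n g f (normalizeS (trimQ (R ++ QMvPoly.smul (-1) (mulN T2 (onePlusSq n g))))) (normalizeS (trimQ (Q ++ T2)))

/-- Divide by `1 + X_g²` as often as the division is EXACT (verified by re-multiplication; fuel-bounded). [folklore] -/
def stripQuad (n g : ℕ) : ℕ → QMvPoly → QMvPoly
  | 0, p => p
  | f + 1, p =>
      let rq := peelQuad n g (maxExpG g p + 1) p []
      if rq.1 = [] ∧ polyEq p (mulN rq.2 (onePlusSq n g)) = true then stripQuad n g f rq.2 else p

/-- `stripQuad p` has a zero at `z` iff `p` has (precisely: `p(z) = (1 + z_g²)^k · (stripQuad p)(z)` for some `k`). [folklore] -/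
theorem ev_stripQuad (z : EuclideanSpace ℝ (Fin n)) (g : Fin n) :
    ∀ (f : ℕ) (p : QMvPoly), ∃ k : ℕ, ev n p z = (1 + z g ^ 2) ^ k * ev n (stripQuad n g f p) z := by
  intro f
  induction f with
  | zero => intro p; exact ⟨0, by simp [stripQuad]⟩
  | succ f ih =>
    intro p
    simp only [stripQuad]
    split_ifs with h
    · obtain ⟨k, hk⟩ := ih (peelQuad n g (maxExpG g p + 1) p []).2
      refine ⟨k + 1, ?_⟩
      rw [ev_eq_of_polyEq h.2 z, ev_mulN, hk, onePlusSq, ev_append, ev_powQN, ev_var]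
      simp [ev, QMvPoly.toMv_const, toFun_apply]
      ring
    · exact ⟨0, by simp⟩

/-- CONTENT REMOVAL: strip the power of `X_g`, then the powers of `1 + X_g²`. [folklore] -/
def stripC (n g : ℕ) (p : QMvPoly) : QMvPoly :=
  let q := stripG n g p
  stripQuad n g (maxExpG g q + 1) q

/-- If `p(z) = 0` and `z_g ≠ 0` then `(stripC p)(z) = 0`. [folklore] -/
theorem ev_stripC_eq_zero (z : EuclideanSpace ℝ (Fin n)) (g : Fin n) (hg : z g ≠ 0) {p : QMvPoly} (hp : ev n p z = 0) :
    ev n (stripC n g p) z = 0 := by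
  have h1 := ev_stripG z g p
  rw [hp] at h1
  have h2 : ev n (stripG n g p) z = 0 := by
    rcases mul_eq_zero.1 h1 with h | h
    · exact absurd (pow_eq_zero_iff' |>.1 h).1 hg
    · exact h
  obtain ⟨k, hk⟩ := ev_stripQuad z g (maxExpG g (stripG n g p) + 1) (stripG n g p)
  rw [h2] at hk
  have hpos : (1 + z g ^ 2) ^ k ≠ 0 := pow_ne_zero _ (by positivity)
  rcases mul_eq_zero.1 hk.symm with h | h
  · exact absurd h hpos
  · simpa [stripC] using h

/-! ### Transcript trees with content removal -/

/-- The pin list contains the variable `X_g` (syntactically). [folklore] -/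
def hasVarPin (n g : ℕ) (pins : List QMvPoly) : Bool := pins.any fun π => polyEq π (QMvPoly.var n g)

/-- A pin equal to `X_g` makes `z_g ≠ 0`. [folklore] -/
theorem zg_ne_zero_of_hasVarPin {g : Fin n} {pins : List QMvPoly} {z : EuclideanSpace ℝ (Fin n)}
    (h : hasVarPin n g pins = true) (hp : ∀ π ∈ pins, ev n π z ≠ 0) : z g ≠ 0 := by
  simp only [hasVarPin, List.any_eq_true] at h
  obtain ⟨π, hπ, he⟩ := h
  have := hp π hπ
  rwa [ev_eq_of_polyEq he z, ev_var] at this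

/-- **THE TRANSCRIPT CHECK with content removal in the letter `g`** (laws only; pins and signs untouched). [folklore] -/
def etreeCheckG (n g : ℕ) : List QMvPoly → List QMvPoly → List ℕ → List QMvPoly → ETree → Bool
  | hyps, pins, zs, nonneg, .leaf c => pointCheckP n hyps pins zs nonneg c
  | hyps, pins, zs, nonneg, .chunk comb T t =>
      polyEq T (idealComb hyps comb) && etreeCheckG n g (hyps ++ [T]) pins zs nonneg t
  | hyps, pins, zs, nonneg, .split π nz z => etreeCheckG n g hyps (pins ++ [π]) zs nonneg nz && etreeCheckG n g (hyps ++ [π]) pins zs nonneg z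
  | hyps, pins, zs, nonneg, .elim k i κ pe t =>
      let L := hyps.getD k []
      let c := coeffIn i L
      let num := QMvPoly.smul (-1) (restIn i L)
      decide (i < n) && decide (g < n) && hasVarPin n g pins && decide (κ ≠ 0) && decide (degIn i L ≤ 1) &&
        polyEq c (QMvPoly.smul κ (pinProductN pins pe)) &&
        etreeCheckG n g (hyps.map fun P => stripC n g (substLawN i num c P)) (pins.map (substLawN i num c)) zs (nonneg.map (substSignN i num c)) t
  | hyps, pins, zs, nonneg, .force k j κ pe e t =>
      decide (j < n) && decide (κ ≠ 0) && decide (1 ≤ e) &&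
        polyEq (hyps.getD k []) (QMvPoly.smul κ (mulN (pinProductN pins pe) (powQN (QMvPoly.var n j) e))) &&
        etreeCheckG n g (hyps ++ [QMvPoly.var n j]) pins zs nonneg t

/-- **SOUNDNESS OF TRANSCRIPT TREES WITH CONTENT REMOVAL.** [folklore] -/
theorem not_pointDatum_of_etreeCheckG (g : ℕ) : ∀ (t : ETree) {hyps pins : List QMvPoly} {zs : List ℕ} {nonneg : List QMvPoly},
    etreeCheckG n g hyps pins zs nonneg t = true → ¬ PointDatum n hyps pins zs nonneg := by
  intro t
  induction t with
  | leaf c => intro hyps pins zs nonneg h; exact not_pointDatum_of_pointCheckP h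
  | chunk comb T t ih =>
    intro hyps pins zs nonneg h hd
    simp only [etreeCheckG, Bool.and_eq_true] at h
    obtain ⟨z, hh, hp, hz, hq⟩ := hd
    refine ih h.2 ⟨z, ?_, hp, hz, hq⟩
    intro L hL
    rcases List.mem_append.1 hL with hL' | hL'
    · exact hh L hL'
    · rw [List.mem_singleton.1 hL', ev_eq_of_polyEq h.1 z, ev_idealComb_eq_zero z hyps hh]
  | split π nz zt ihnz ihz =>
    intro hyps pins zs nonneg h hd
    simp only [etreeCheckG, Bool.and_eq_true] at h
    obtain ⟨z, hh, hp, hz, hq⟩ := hd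
    by_cases hπ : ev n π z = 0
    · refine ihz h.2 ⟨z, ?_, hp, hz, hq⟩
      intro L hL
      rcases List.mem_append.1 hL with hL' | hL'
      · exact hh L hL'
      · rw [List.mem_singleton.1 hL']; exact hπ
    · refine ihnz h.1 ⟨z, hh, ?_, hz, hq⟩
      intro π' hπ'
      rcases List.mem_append.1 hπ' with h' | h'
      · exact hp π' h'
      · rw [List.mem_singleton.1 h']; exact hπ
  | elim k i κ pe t ih =>
    intro hyps pins zs nonneg h hd
    simp only [etreeCheckG, Bool.and_eq_true, decide_eq_true_eq] at h
    obtain ⟨⟨⟨⟨⟨⟨hi, hgn⟩, hvp⟩, hκ⟩, hdeg⟩, hc⟩, ht⟩ := h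
    obtain ⟨z, hh, hp, hz, hq⟩ := hd
    set L := hyps.getD k [] with hL
    set c := coeffIn i L with hc_def
    set num := QMvPoly.smul (-1) (restIn i L) with hnum
    have hcz : ev n c z ≠ 0 := by
      rw [ev_eq_of_polyEq hc z, ev_smul, ev_pinProductN]
      exact mul_ne_zero (by exact_mod_cast hκ) (ev_pinProduct_ne_zero z pins pe hp)
    have hLz : ev n L z = 0 := ev_getD_eq_zero hh k
    have hlin := ev_linear_split z ⟨i, hi⟩ L hdeg
    have hzi : ev n c z * z ⟨i, hi⟩ = ev n num z := by
      rw [hnum, ev_smul]; push_cast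
      have : z ⟨i, hi⟩ * ev n c z + ev n (restIn i L) z = 0 := by rw [← hLz, hlin]
      linarith
    have hzg : z ⟨g, hgn⟩ ≠ 0 := zg_ne_zero_of_hasVarPin (g := ⟨g, hgn⟩) hvp hp
    refine ih ht ⟨z, ?_, ?_, hz, ?_⟩
    · intro L' hL'
      obtain ⟨P, hP, rfl⟩ := List.mem_map.1 hL'
      exact ev_stripC_eq_zero z ⟨g, hgn⟩ hzg (ev_substLawN_eq_zero z ⟨i, hi⟩ num c hzi (hh P hP))
    · intro π' hπ'
      obtain ⟨P, hP, rfl⟩ := List.mem_map.1 hπ'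
      exact ev_substLawN_ne_zero z ⟨i, hi⟩ num c hzi hcz (hp P hP)
    · intro q' hq'
      obtain ⟨P, hP, rfl⟩ := List.mem_map.1 hq'
      exact ev_substSignN_nonneg z ⟨i, hi⟩ num c hzi (hq P hP)
  | force k j κ pe e t ih =>
    intro hyps pins zs nonneg h hd
    simp only [etreeCheckG, Bool.and_eq_true, decide_eq_true_eq] at h
    obtain ⟨⟨⟨⟨hj, hκ⟩, he⟩, hform⟩, ht⟩ := h
    obtain ⟨z, hh, hp, hz, hq⟩ := hd
    have hLz : ev n (hyps.getD k []) z = 0 := ev_getD_eq_zero hh k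
    rw [ev_eq_of_polyEq hform z, ev_smul, ev_mulN, ev_pinProductN, ev_powQN, ev_var z ⟨j, hj⟩] at hLz
    have hzj : z ⟨j, hj⟩ = 0 := by
      have h1 : (κ : ℝ) ≠ 0 := by exact_mod_cast hκ
      have h2 := ev_pinProduct_ne_zero z pins pe hp
      have h3 : z ⟨j, hj⟩ ^ e = 0 := by
        rcases mul_eq_zero.1 hLz with h | h
        · exact absurd h h1
        · rcases mul_eq_zero.1 h with h' | h'
          · exact absurd h' h2
          · exact h'
      exact pow_eq_zero_iff (by omega) |>.1 h3
    refine ih ht ⟨z, ?_, hp, hz, hq⟩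
    intro L hL
    rcases List.mem_append.1 hL with hL' | hL'
    · exact hh L hL'
    · rw [List.mem_singleton.1 hL', ev_var z ⟨j, hj⟩]; exact hzj

/-- **THE KILL CHECK with content removal** (`g` = the pinned tilt letter). [folklore] -/
def killCheckG (n g : ℕ) (hyps pins : List QMvPoly) (zs : List ℕ) (nonneg : List QMvPoly) (J : List ℕ) (t : ETree) : Bool :=
  (J.all fun j => decide (j < n)) && etreeCheckG n g hyps (pins ++ [sumSq n J]) zs nonneg t

/-- **SOUNDNESS OF THE KILL CHECK with content removal.** [folklore] -/
theorem kills_of_killCheckG {g : ℕ} {hyps pins : List QMvPoly} {zs : List ℕ} {nonneg : List QMvPoly} {J : List ℕ} {t : ETree}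
    (h : killCheckG n g hyps pins zs nonneg J t = true) : Kills n hyps pins zs nonneg J := by
  simp only [killCheckG, Bool.and_eq_true, List.all_eq_true, decide_eq_true_eq] at h
  obtain ⟨-, ht⟩ := h
  intro z hh hp hz hq j hjJ hj
  by_contra hne
  refine not_pointDatum_of_etreeCheckG g t ht ⟨z, hh, ?_, hz, hq⟩
  intro π hπ
  rcases List.mem_append.1 hπ with h' | h'
  · exact hp π h'
  · rw [List.mem_singleton.1 h', ev_sumSq]
    have hnn : ∀ x ∈ J.map (fun j => ev n (QMvPoly.var n j) z * ev n (QMvPoly.var n j) z), (0 : ℝ) ≤ x := by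
      intro x hx
      obtain ⟨j', -, rfl⟩ := List.mem_map.1 hx
      exact mul_self_nonneg _
    have hmem : ev n (QMvPoly.var n j) z * ev n (QMvPoly.var n j) z ∈
        J.map (fun j => ev n (QMvPoly.var n j) z * ev n (QMvPoly.var n j) z) := List.mem_map.2 ⟨j, hjJ, rfl⟩
    have hle := List.single_le_sum hnn _ hmem
    have hpos : 0 < ev n (QMvPoly.var n j) z * ev n (QMvPoly.var n j) z := by
      rw [ev_var z ⟨j, hj⟩]; exact mul_self_pos.2 hne
    exact ne_of_gt (lt_of_lt_of_le hpos hle)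

/-! ### Self-test (`decide +kernel`)

Letters `X₀ = g` (pinned), `X₁ = s`, `X₂ = B` (twist).  Laws: `g·s − (1+g²) = 0` (pivot on `s`, coefficient `g`: pe = [1]), `s·B − g·B = 0`.
After `s := (1+g²)/g` the second law reads `(1+g²)·B − g²·B = B`; content removal leaves `B`; `force` kills it. -/

/-- Toy transcript with content removal. [folklore] -/
theorem example_killCheckG :
    killCheckG 3 0 [[([1, 1, 0], (1 : ℚ)), ([0, 0, 0], (-1 : ℚ)), ([2, 0, 0], (-1 : ℚ))], [([0, 1, 1], (1 : ℚ)), ([1, 0, 1], (-1 : ℚ))]]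
      [QMvPoly.var 3 0] [] [] [2]
      (.elim 0 1 1 [1] (.force 1 2 1 [] 1 (.elim 2 2 1 [] (.leaf { steps := [], comb := [], e := [0, 1], sos0 := [], sosG := [] })))) = true := by
  decide +kernel

end Summit.NavierStokesRegularity.NavierStokesRegularity.Theorems.PoloidalWindowDoorLrcModEntireJetCertPsatzElimG

end
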